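import Summits.QuantumFields.YangMills.Theorems.BalabanLadderNTWeakPackageCoverThreePointSeq
import Summits.QuantumFields.YangMills.Theorems.BalabanLadderNTWeakPackageCover
import HarnessLib

/-!
# Crux `NT` (stmt-QuantumFields-19353), stub `stub_cfpw : CFPW`: the floor package `FBL ∧ (F) ∧ (T)` from the GEOMETRIC package (route-independent)

Helper file (`--supports stmt-QuantumFields-19353`) of the fleet lead prover of crux `NT` (unit `ym-spine-19353-p1`,
g3).  Route-independent companion of `…NTGeometricPackage` (which imports the route file to conclude `BalabanLadder.NT`
by name): for ONE `(G, r, a)` with `0 < a`, the three engine statements on the engine's own geometric radii `R_k` —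
(E1-osc) the exterior-to-exterior oscillation bound of the central kernel mean on the centred femto cubes, (E2′) the
forward-cone two-point floor and (E3) the signed third-cumulant floor on the x-centred femto cubes of radii `R_k`
(antitone collars, positive monotone shapes with growth) — give the FLOOR PACKAGE `FBL G r a ∧ (F) ∧ (T)` in the registry's
`∀ s₀`-collar texts (`floorPackage_of_geometric`).  This is the input shape of the seam's femto discharge
`UVSeamRec.WeakWindow.stubFloorsEngine_of_floorWindow_rF` (`Theorems/BalabanLadderUVSeamRecFloorsEngineOfWeakWindowRF.lean`,
at `G = SU(2)`, `r = fundamentalLatticeRep 2`) and of `WeakPackage.lowerBounds_of_floorPackage` /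
`cfpwBody_of_floorPackage`; no route file is imported here.
-/

set_option autoImplicit false

noncomputable section

open MeasureTheory Filter Topology
open Literature.MathematicalPhysics.QuantumFieldTheory Literature.MathematicalPhysics.QuantumLattice
open Literature.Probability.LatticeModels
open Summit.QuantumFields.YangMills.Cruxes.OSLegsFromFemtoAndGap.DlrCollarTransfer
open Summit.QuantumFields.YangMills.Cruxes.NT.BoundaryLaw (fbl_of_oscillation_seq)

namespace Summit.QuantumFields.YangMills.Cruxes.NT.WeakPackage

section Lattice

variable (G : Type) [Group G] [TopologicalSpace G] [IsTopologicalGroup G] [CompactSpace G]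
  [MeasurableSpace G] [BorelSpace G] (r : LatticeRep G) (a : ℝ → ℝ)

/-- **The floor package from the geometric package.**  For a unit map `0 < a` and an unbounded sequence of radii `R_k`
with `R_{k+1} + 1 ≤ θ (R_k + 1)` (`θ ≥ 1`): (E1-osc), (E2′) and (E3) on the cubes of radii `R_k` give
`FBL G r a ∧ (F) ∧ (T)` — the boundary law and the registered weak floor / third-cumulant clauses of `CFPW` on ALL femto
cubes (`fbl_of_oscillation_seq`, `floorClause_of_seq`, `fc3Weak_of_seq`). [folklore] -/
theorem floorPackage_of_geometric (hapos : ∀ β, 0 < a β)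
    (Rs : ℕ → ℕ) (θ : ℝ) (hθ : 1 ≤ θ) (hgap : ∀ k, (Rs (k + 1) : ℝ) + 1 ≤ θ * ((Rs k : ℝ) + 1))
    (hunb : ∀ R : ℕ, ∃ k, R < Rs k)
    (hE1 : ∃ (C₁ β₁ ℓ₁ : ℝ), 0 < ℓ₁ ∧ ∀ β : ℝ, β₁ ≤ β → ∀ k : ℕ,
      ((2 * Rs k + 1 : ℕ) : ℝ) * a β ≤ ℓ₁ → ∀ η η' : LGConfig 4 G,
        |kerE G r β (fun _ => -(Rs k : ℤ)) (2 * Rs k + 1) η (dens G r 0) -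
          kerE G r β (fun _ => -(Rs k : ℤ)) (2 * Rs k + 1) η' (dens G r 0)| ≤ C₁ / ((Rs k : ℝ) + 1) ^ 4)
    (hE2 : ∃ (Γ : ℝ → ℝ) (β₂ ℓ₂ c₂ : ℝ) (K : ℝ → ℝ) (n₀ : ℕ), 0 < ℓ₂ ∧ 0 < c₂ ∧ (∀ s, 1 ≤ K s) ∧
      AntitoneOn K (Set.Ioi 0) ∧ Tendsto (fun s : ℝ => s * K s) (nhdsWithin 0 (Set.Ioi 0)) (nhds 0) ∧ 1 ≤ n₀ ∧
      Tendsto (fun s : ℝ => Γ s / s ^ 8) (nhdsWithin 0 (Set.Ioi 0)) atTop ∧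
      (∀ s : ℝ, 0 < s → s ≤ ℓ₂ → 0 < Γ s) ∧ MonotoneOn Γ (Set.Ioc 0 ℓ₂) ∧
      ∀ β : ℝ, β₂ ≤ β → ∀ (x : Fin 4 → ℤ) (k : ℕ), ((2 * Rs k + 1 : ℕ) : ℝ) * a β ≤ ℓ₂ →
        ∀ (η : LGConfig 4 G) (y : Fin 4 → ℤ), 0 < ‖siteToE (y - x)‖ * a β →
          (n₀ : ℝ) ≤ ‖siteToE (y - x)‖ → ‖siteToE (y - x)‖ < 3 * siteToE (y - x) 0 →
            K (‖siteToE (y - x)‖ * a β) * ‖siteToE (y - x)‖ ≤ depth (fun j => x j - Rs k) (2 * Rs k + 1) y →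
              c₂ * Γ (‖siteToE (y - x)‖ * a β) ≤
                ‖siteToE (y - x)‖ ^ 8 *
                  kerCov G r β (fun j => x j - Rs k) (2 * Rs k + 1) η (dens G r x) (dens G r y))
    (hE3 : ∃ (v w : EuclideanSpace ℝ (Fin 4)) (σ δ : ℝ) (Γ₃ : ℝ → ℝ) (β₃ ℓ₃ c₃ : ℝ) (K₃ : ℝ → ℝ) (n₃ : ℕ),
      (σ = 1 ∨ σ = -1) ∧ 0 < δ ∧ 2 * δ < ‖v‖ ∧ 2 * δ < ‖w‖ ∧ 2 * δ < ‖v - w‖ ∧ 0 < ℓ₃ ∧ 0 < c₃ ∧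
      (∀ s, 1 ≤ K₃ s) ∧ AntitoneOn K₃ (Set.Ioi 0) ∧
      Tendsto (fun s : ℝ => s * K₃ s) (nhdsWithin 0 (Set.Ioi 0)) (nhds 0) ∧
      Tendsto (fun s : ℝ => Γ₃ s / s ^ 4) (nhdsWithin 0 (Set.Ioi 0)) atTop ∧
      (∀ s : ℝ, 0 < s → s ≤ ℓ₃ → 0 < Γ₃ s) ∧ MonotoneOn Γ₃ (Set.Ioc 0 ℓ₃) ∧
      ∀ β : ℝ, β₃ ≤ β → ∀ (x : Fin 4 → ℤ) (k : ℕ), ((2 * Rs k + 1 : ℕ) : ℝ) * a β ≤ ℓ₃ →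
        ∀ (η : LGConfig 4 G) (n : ℕ) (y z : Fin 4 → ℤ), 0 < (n : ℝ) * a β →
          n₃ ≤ n → ‖siteToE (y - x) - (n : ℝ) • v‖ ≤ δ * n → ‖siteToE (z - x) - (n : ℝ) • w‖ ≤ δ * n →
            K₃ ((n : ℝ) * a β) * n ≤ depth (fun j => x j - Rs k) (2 * Rs k + 1) x →
            K₃ ((n : ℝ) * a β) * n ≤ depth (fun j => x j - Rs k) (2 * Rs k + 1) y →
            K₃ ((n : ℝ) * a β) * n ≤ depth (fun j => x j - Rs k) (2 * Rs k + 1) z →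
              c₃ * Γ₃ ((n : ℝ) * a β) ≤
                σ * (n : ℝ) ^ 12 * kerK3 G r β (fun j => x j - Rs k) (2 * Rs k + 1) η x y z) :
    FBL G r a ∧
    (∃ (Γ : ℝ → ℝ) (β₂ ℓ₂ c₂ : ℝ) (K : ℝ → ℝ) (n₀ : ℕ), 0 < ℓ₂ ∧ 0 < c₂ ∧ (∀ s, 1 ≤ K s) ∧
      Tendsto (fun s : ℝ => s * K s) (nhdsWithin 0 (Set.Ioi 0)) (nhds 0) ∧ 1 ≤ n₀ ∧
      Tendsto (fun s : ℝ => Γ s / s ^ 8) (nhdsWithin 0 (Set.Ioi 0)) atTop ∧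
      ∀ β : ℝ, β₂ ≤ β → ∀ (x : Fin 4 → ℤ) (R : ℕ), ((2 * R + 1 : ℕ) : ℝ) * a β ≤ ℓ₂ →
        ∀ (η : LGConfig 4 G) (y : Fin 4 → ℤ) (s₀ : ℝ), 0 < s₀ → s₀ ≤ ‖siteToE (y - x)‖ * a β →
          (n₀ : ℝ) ≤ ‖siteToE (y - x)‖ → ‖siteToE (y - x)‖ < 3 * siteToE (y - x) 0 →
            K s₀ * ‖siteToE (y - x)‖ ≤ depth (fun j => x j - R) (2 * R + 1) y →
              c₂ * Γ (‖siteToE (y - x)‖ * a β) ≤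
                ‖siteToE (y - x)‖ ^ 8 *
                  kerCov G r β (fun j => x j - R) (2 * R + 1) η (dens G r x) (dens G r y)) ∧
    (∃ (v w : EuclideanSpace ℝ (Fin 4)) (σ δ : ℝ) (Γ₃ : ℝ → ℝ) (β₃ ℓ₃ c₃ : ℝ) (K₃ : ℝ → ℝ) (n₃ : ℕ),
      (σ = 1 ∨ σ = -1) ∧ 0 < δ ∧ 2 * δ < ‖v‖ ∧ 2 * δ < ‖w‖ ∧ 2 * δ < ‖v - w‖ ∧ 0 < ℓ₃ ∧ 0 < c₃ ∧
      (∀ s, 1 ≤ K₃ s) ∧ Tendsto (fun s : ℝ => s * K₃ s) (nhdsWithin 0 (Set.Ioi 0)) (nhds 0) ∧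
      Tendsto (fun s : ℝ => Γ₃ s / s ^ 4) (nhdsWithin 0 (Set.Ioi 0)) atTop ∧
      ∀ β : ℝ, β₃ ≤ β → ∀ (x : Fin 4 → ℤ) (R : ℕ), ((2 * R + 1 : ℕ) : ℝ) * a β ≤ ℓ₃ →
        ∀ (η : LGConfig 4 G) (n : ℕ) (y z : Fin 4 → ℤ) (s₀ : ℝ), 0 < s₀ → s₀ ≤ (n : ℝ) * a β →
          n₃ ≤ n → ‖siteToE (y - x) - (n : ℝ) • v‖ ≤ δ * n → ‖siteToE (z - x) - (n : ℝ) • w‖ ≤ δ * n →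
            K₃ s₀ * n ≤ depth (fun j => x j - R) (2 * R + 1) x →
            K₃ s₀ * n ≤ depth (fun j => x j - R) (2 * R + 1) y →
            K₃ s₀ * n ≤ depth (fun j => x j - R) (2 * R + 1) z →
              c₃ * Γ₃ ((n : ℝ) * a β) ≤
                σ * (n : ℝ) ^ 12 * kerK3 G r β (fun j => x j - R) (2 * R + 1) η x y z) := by
  have hFBL : FBL G r a := fbl_of_oscillation_seq G r a hapos Rs θ hgap hunb hE1
  exact ⟨hFBL, floorClause_of_seq G r a hapos hFBL Rs θ hθ hgap hunb hE2,
    fc3Weak_of_seq G r a hapos hFBL Rs θ hθ hgap hunb hE3⟩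

end Lattice

end Summit.QuantumFields.YangMills.Cruxes.NT.WeakPackage

end
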